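import Summits.BirchSwinnertonDyer.BirchSwinnertonDyer.Theorems.KolyvaginRoadThreePTDevissageLocal
import Summits.BirchSwinnertonDyer.BirchSwinnertonDyer.Theorems.KolyvaginRoadThreePTDevissageDuality
import Summits.BirchSwinnertonDyer.BirchSwinnertonDyer.Theorems.KolyvaginRoadThreePTDevissageCofinite
import Summits.BirchSwinnertonDyer.BirchSwinnertonDyer.Theorems.SchneiderFreeAdditiveX3PoitouTateSelmerComplementReduction
import Literature.NumberTheory.GaloisRepresentations.ContinuousCohomologyNineTerm
import HarnessLib

/-!
# Dévissage of Milne I Thm. 4.10(b) — the `S`-unramified LIFTING LEMMA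

For a short exact sequence `0 → M₁ →(f) M₂ →(g) M₃ → 0` of finite discrete `n`-torsion `Γ_K`-modules over
a number field `K`, a finite set of places `S ⊇ {v ∣ ∞}` off which `v ∤ n` and the modules are
unramified, and a family `inv` of local invariant maps (perfect at finite places, injective at real
places, Milne I 2.6): **a class `x₃ ∈ H¹(K, M₃)` unramified outside `S` whose localisations at the places
of `S` lift to `H¹(K_v, M₂)` lifts to a class `x₂ ∈ H¹(K, M₂)` UNRAMIFIED OUTSIDE `S`**
(`exists_map_eq_of_unramifiedOutside`), provided
(a) `Ш²(K, M₁) = 0` (all places), (b) Milne I 4.10(b) `Ker γ¹ ⊆ Im β¹` holds for `M₁` at every finite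
`S' ⊇ S`, and (c) `H¹(K, M₁^D)` has no non-zero class vanishing on `S` and unramified off `S`.
Mechanism: `δ₁ x₃ ∈ H²(K, M₁)` is locally zero everywhere (at `S` by the local lifts, off `S` because
`δ₁` kills unramified classes — `cd(Ẑ) = 1`), so `x₃ = H¹(g) x₂⁰` by (a); `x₂⁰` is unramified outside a
finite `S ∪ T` (Milne I Lemma 4.8) and at `T` its localisation is unramified modulo `H¹(f) H¹(K_v, M₁)`;
Howard's Thm. 2.1.11 for `M₁` (from (b), tree `exists_selmer_sub_mem_of_middleExact`) with the Selmer
pair `𝓕 ≤ 𝓖` = (`f⁻¹ H¹_ur(M₂)` at `T`, everything at `S`) ≤ (everything at `S ∪ T`) produces the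
correction `x_A ∈ H¹(K, M₁)`, its obstruction group `H¹_{𝓕*}(K, M₁^D)` being inside the group of (c).
Theorems only; no case of BSD; the one instance aimed at is `M₂ = E[3]` over the `3`-Sylow fixed field
(crux `ZhangSharpFrameAtThreeHL`, stub PT).

References: [MilneADT2006] I Lemma 4.8, Thm. 4.10; [Howard2004HeegnerKolyvagin] Thm. 2.1.11.
-/

noncomputable section

open CategoryTheory Function NumberField IsDedekindDomain
open scoped NumberField ContRepresentation

universe u

set_option linter.dupNamespace false
set_option autoImplicit false

namespace Summit.BirchSwinnertonDyer.BirchSwinnertonDyer.Theorems.KolyvaginRoadThreePT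

open Field
open Literature.NumberTheory.GaloisRepresentations Literature.NumberTheory.GaloisCohomology
open Literature.NumberTheory.GaloisRepresentations.DiscreteGaloisModule (mu MuCarrier TateDual tateDual
  localTatePairingZMod homOfIntertwining unramifiedSubgroup SelmerStructure)
open _root_.TopRep _root_.ContRepresentation _root_.ContinuousCohomology
open Summit.BirchSwinnertonDyer.Rank1Residual.X11b.FiniteDuality
open Summit.BirchSwinnertonDyer.BirchSwinnertonDyer.Theorems.SchneiderFreeAdditiveX3.PoitouTateReduction

variable {K : Type u} [Field K] [NumberField K] {n : ℕ} [NeZero n]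
variable {M₁ M₂ M₃ : Type u}
  [AddCommGroup M₁] [TopologicalSpace M₁] [DiscreteTopology M₁] [Finite M₁]
  [AddCommGroup M₂] [TopologicalSpace M₂] [DiscreteTopology M₂] [Finite M₂]
  [AddCommGroup M₃] [TopologicalSpace M₃] [DiscreteTopology M₃] [Finite M₃]
variable {ρ₁ : DiscreteGaloisModule K M₁} {ρ₂ : DiscreteGaloisModule K M₂}
  {ρ₃ : DiscreteGaloisModule K M₃}
variable {f : ρ₁.toContRepresentation →ⁱL ρ₂.toContRepresentation}
  {g : ρ₂.toContRepresentation →ⁱL ρ₃.toContRepresentation}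

/-! ## Small helpers -/

omit [NumberField K] [NeZero n] [Finite M₁] [Finite M₂] [Finite M₃] in
/-- `H¹(g) ∘ H¹(f) = 0` for a short exact sequence. [cite: SerreGaloisCohomology1997, I §2.2] -/
theorem map_map_eq_zero (h : IsSES (homOfIntertwining f) (homOfIntertwining g))
    (a : galoisCohomology ρ₁ 1) : galoisCohomology.map g 1 (galoisCohomology.map f 1 a) = 0 :=
  h.map_one_map_one a

omit [NeZero n] [Finite M₁] [Finite M₂] [Finite M₃] in
/-- At a place where `M₂` is unramified, the local inertia group acts trivially on `M₂|_{Γ_{K_v}}`.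
[cite: NeukirchANT1999, Ch. II §9 Prop. (9.6)] -/
theorem toLocal_apply_eq_self_of_isUnramifiedAt (v : HeightOneSpectrum (𝓞 K))
    (hur : GaloisRep.IsUnramifiedAt v ρ₂) :
    ∀ t ∈ absInertia (v.adicCompletion K), ∀ m : M₂, (ρ₂.toLocal (Sum.inr v)) t m = m := by
  intro t ht m
  have h := (GaloisRep.isUnramifiedAt_iff_toLocal_holds v ρ₂).1 hur t ht
  change GaloisRep.toLocal v ρ₂ t m = m
  rw [h]
  rfl

omit [NumberField K] [NeZero n] [Finite M₁] [Finite M₂] [Finite M₃] in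
/-- The short exact sequence restricted to a completion, in the `→ⁱL` currency. [folklore] -/
theorem isSES_restrictField (h : IsSES (homOfIntertwining f) (homOfIntertwining g)) (E : Type u)
    [Field E] [Algebra K E] :
    IsSES (homOfIntertwining (f.restrictField E)) (homOfIntertwining (g.restrictField E)) :=
  h.restrictField E

omit [NeZero n] [Finite M₁] [Finite M₂] [Finite M₃] in
/-- Localisation commutes with the change of coefficients (the tree's `res_map_one` in the
`localization` spelling). [cite: SerreGaloisCohomology1997, I §2.4] -/
theorem localization_map_one' {N₁ N₂ : Type u} [AddCommGroup N₁] [TopologicalSpace N₁]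
    [DiscreteTopology N₁] [AddCommGroup N₂] [TopologicalSpace N₂] [DiscreteTopology N₂]
    {τ₁ : DiscreteGaloisModule K N₁} {τ₂ : DiscreteGaloisModule K N₂}
    (φ : τ₁.toContRepresentation →ⁱL τ₂.toContRepresentation) (v : Place K) (c : galoisCohomology τ₁ 1) :
    galoisCohomology.localization τ₂ v 1 (galoisCohomology.map φ 1 c) =
      galoisCohomology.map (φ.restrictField (Place.Completion v)) 1
        (galoisCohomology.localization τ₁ v 1 c) :=
  galoisCohomology.res_map_one (Place.Completion v) φ c

/-! ## The lifting lemma -/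

omit [Finite M₂] [Finite M₃] in
/-- **`S`-unramified lifting along `H¹(g)`** (see the module docstring): for `x₃ ∈ H¹(K, M₃)` unramified
outside `S` with `loc_v x₃ ∈ H¹(g)(H¹(K_v, M₂))` for `v ∈ S`, there is `x₂ ∈ H¹(K, M₂)` unramified outside
`S` with `H¹(g) x₂ = x₃`, granted `Ш²(K, M₁) = 0`, Milne I 4.10(b) for `M₁` at all finite `S' ⊇ S`, and
the vanishing of the classes of `M₁^D` trivial on `S` and unramified off `S`.
[cite: MilneADT2006, Ch. I, Thm. 4.10 and Lemma 4.8] [cite: Howard2004HeegnerKolyvagin, Thm. 2.1.11 (arXiv:1202.6340 p. 6)] -/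
theorem exists_map_eq_of_unramifiedOutside (inv : LocalInvariants K n) (hperf : inv.IsPerfect)
    (hreal : inv.InjectiveAtRealPlaces) (hUO : inv.UnramifiedOrthogonal)
    (h : IsSES (homOfIntertwining f) (homOfIntertwining g)) (hM₁ : ∀ m : M₁, n • m = 0)
    {S : Finset (Place K)} (hSinf : ∀ w : InfinitePlace K, (Sum.inl w : Place K) ∈ S)
    (hS : ∀ v : HeightOneSpectrum (𝓞 K), (Sum.inr v : Place K) ∉ S →
      ((n : ℕ) : 𝓞 K) ∉ v.asIdeal ∧ GaloisRep.IsUnramifiedAt v ρ₁ ∧ GaloisRep.IsUnramifiedAt v ρ₂)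
    (hE₁ : ∀ S' : Finset (Place K), S ⊆ S' →
      ∀ t : Π v : Place K, galoisCohomology (ρ₁.toLocal v) 1,
        (∀ y : galoisCohomology (ρ₁.tateDual n) 1,
          (∀ v : HeightOneSpectrum (𝓞 K), (Sum.inr v : Place K) ∉ S' →
            galoisCohomology.localization (ρ₁.tateDual n) (Sum.inr v) 1 y ∈
              unramifiedSubgroup (GaloisRep.toLocal v (ρ₁.tateDual n)) 1) →
          ∑ v ∈ S', localTatePairingZMod ρ₁ n v (inv v) (t v)
            (galoisCohomology.localization (ρ₁.tateDual n) v 1 y) = 0) →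
        ∃ x : galoisCohomology ρ₁ 1,
          (∀ v : HeightOneSpectrum (𝓞 K), (Sum.inr v : Place K) ∉ S' →
            galoisCohomology.localization ρ₁ (Sum.inr v) 1 x ∈
              unramifiedSubgroup (GaloisRep.toLocal v ρ₁) 1) ∧
          ∀ v ∈ S', galoisCohomology.localization ρ₁ v 1 x = t v)
    (hSha₁ : ∀ z : galoisCohomology ρ₁ 2,
      (∀ v : Place K, galoisCohomology.localization ρ₁ v 2 z = 0) → z = 0)
    (hH₁ : ∀ y : galoisCohomology (ρ₁.tateDual n) 1,
      (∀ v ∈ S, galoisCohomology.localization (ρ₁.tateDual n) v 1 y = 0) →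
      (∀ v : HeightOneSpectrum (𝓞 K), (Sum.inr v : Place K) ∉ S →
        galoisCohomology.localization (ρ₁.tateDual n) (Sum.inr v) 1 y ∈
          unramifiedSubgroup (GaloisRep.toLocal v (ρ₁.tateDual n)) 1) → y = 0)
    (x₃ : galoisCohomology ρ₃ 1)
    (hx₃ur : ∀ v : HeightOneSpectrum (𝓞 K), (Sum.inr v : Place K) ∉ S →
      galoisCohomology.localization ρ₃ (Sum.inr v) 1 x₃ ∈ unramifiedSubgroup (GaloisRep.toLocal v ρ₃) 1)
    (hx₃S : ∀ v ∈ S, ∃ m : galoisCohomology (ρ₂.toLocal v) 1,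
      galoisCohomology.map (g.restrictField (Place.Completion v)) 1 m =
        galoisCohomology.localization ρ₃ v 1 x₃) :
    ∃ x₂ : galoisCohomology ρ₂ 1,
      (∀ v : HeightOneSpectrum (𝓞 K), (Sum.inr v : Place K) ∉ S →
        galoisCohomology.localization ρ₂ (Sum.inr v) 1 x₂ ∈ unramifiedSubgroup (GaloisRep.toLocal v ρ₂) 1) ∧
      galoisCohomology.map g 1 x₂ = x₃ := by
  classical
  haveI := absoluteGaloisGroup_compactSpace K
  -- (1) `δ₁ x₃` is locally trivial everywhere, hence zero; lift `x₃` to `x₂⁰`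
  have hδ : h.δ₁ x₃ = 0 := by
    refine hSha₁ _ fun v => ?_
    by_cases hvS : v ∈ S
    · haveI := absoluteGaloisGroup_compactSpace (Place.Completion (K := K) v)
      have hv := isSES_restrictField h (Place.Completion (K := K) v)
      have e : galoisCohomology.localization ρ₁ v 2 (h.δ₁ x₃) =
          hv.δ₁ (galoisCohomology.localization ρ₃ v 1 x₃) :=
        IsSES.res_field_δ₁ (E := Place.Completion (K := K) v) h x₃
      obtain ⟨m, hm⟩ := hx₃S v hvS
      rw [e, ← hm]
      exact hv.δ₁_map_one m
    · obtain ⟨w, rfl⟩ : ∃ w : HeightOneSpectrum (𝓞 K), v = Sum.inr w := by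
        rcases v with w | w
        · exact absurd (hSinf w) hvS
        · exact ⟨w, rfl⟩
      haveI := absoluteGaloisGroup_compactSpace (w.adicCompletion K)
      have hv := isSES_restrictField h (w.adicCompletion K)
      have e : galoisCohomology.localization ρ₁ (Sum.inr w) 2 (h.δ₁ x₃) =
          hv.δ₁ (galoisCohomology.res ρ₃ (w.adicCompletion K) 1 x₃) :=
        IsSES.res_field_δ₁ (E := w.adicCompletion K) h x₃
      rw [e]
      exact δ₁_eq_zero_of_mem_unramifiedSubgroup hv
        (toLocal_apply_eq_self_of_isUnramifiedAt w (hS w hvS).2.2) (hx₃ur w hvS)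
  obtain ⟨x20, hx20eq⟩ : ∃ x : galoisCohomology ρ₂ 1, galoisCohomology.map g 1 x = x₃ :=
    h.exists_map_one_eq_of_δ₁_eq_zero x₃ hδ
  -- (2) the finite set `T` of places off which `x₂⁰` is unramified
  obtain ⟨T, hT⟩ := exists_finset_localization_mem_unramifiedSubgroup ρ₂ x20
  set S' : Finset (Place K) := S ∪ T.image Sum.inr with hS'def
  have hSS' : S ⊆ S' := Finset.subset_union_left
  have memS' : ∀ w : HeightOneSpectrum (𝓞 K), (Sum.inr w : Place K) ∈ S' ↔
      (Sum.inr w : Place K) ∈ S ∨ w ∈ T := fun w => by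
    rw [hS'def, Finset.mem_union, Finset.mem_image]
    constructor
    · rintro (h1 | ⟨a, ha, hinj⟩)
      · exact Or.inl h1
      · exact Or.inr (Sum.inr_injective hinj ▸ ha)
    · rintro (h1 | h1)
      · exact Or.inl h1
      · exact Or.inr ⟨w, h1, rfl⟩
  -- (3) the defects `a_w` with `loc_w x₂⁰ ≡ H¹(f) a_w (mod H¹_ur)` at the finite places off `S`
  have hdef : ∀ w : HeightOneSpectrum (𝓞 K),
      ∃ a : galoisCohomology (GaloisRep.restrictField (w.adicCompletion K) ρ₁) 1,
      (Sum.inr w : Place K) ∉ S →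
        galoisCohomology.res ρ₂ (w.adicCompletion K) 1 x20 -
          galoisCohomology.map (f.restrictField (w.adicCompletion K)) 1 a ∈
          unramifiedSubgroup (GaloisRep.toLocal w ρ₂) 1 := by
    intro w
    by_cases hw : (Sum.inr w : Place K) ∈ S
    · exact ⟨0, fun h' => absurd hw h'⟩
    · have hv := isSES_restrictField h (w.adicCompletion K)
      have hm : galoisCohomology.map (g.restrictField (w.adicCompletion K)) 1
          (galoisCohomology.res ρ₂ (w.adicCompletion K) 1 x20) ∈
          unramifiedSubgroup (GaloisRep.toLocal w ρ₃) 1 := by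
        rw [← galoisCohomology.res_map_one (w.adicCompletion K) g x20, hx20eq]
        exact hx₃ur w hw
      obtain ⟨a, ha⟩ := exists_sub_map_mem_unramifiedSubgroup hv
        (toLocal_apply_eq_self_of_isUnramifiedAt w (hS w hw).2.2) hm
      exact ⟨a, fun _ => ha⟩
  choose a ha using hdef
  -- the target family for `M₁`
  let t : Π v : Place K, galoisCohomology (ρ₁.toLocal v) 1 := fun v =>
    match v with
    | Sum.inl _ => 0
    | Sum.inr w => a w
  have ht_inr : ∀ w, t (Sum.inr w) = a w := fun w => rfl
  -- (4) the Selmer pair `𝓕 ≤ 𝓖` on `M₁`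
  let 𝓖 : SelmerStructure ρ₁ := fun v =>
    match v with
    | Sum.inl _ => ⊤
    | Sum.inr w => if (Sum.inr w : Place K) ∈ S' then ⊤ else unramifiedSubgroup (GaloisRep.toLocal w ρ₁) 1
  let 𝓕loc : Π w : HeightOneSpectrum (𝓞 K), AddSubgroup (galoisCohomology (ρ₁.toLocal (Sum.inr w)) 1) :=
    fun w => (unramifiedSubgroup (GaloisRep.toLocal w ρ₂) 1).comap
      (galoisCohomology.map (f.restrictField (w.adicCompletion K)) 1)
  let 𝓕 : SelmerStructure ρ₁ := fun v =>
    match v with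
    | Sum.inl _ => ⊤
    | Sum.inr w => if (Sum.inr w : Place K) ∈ S then ⊤ else
        if w ∈ T then 𝓕loc w else unramifiedSubgroup (GaloisRep.toLocal w ρ₁) 1
  have h𝓖S' : ∀ v : Place K, v ∈ S' → 𝓖 v = ⊤ := fun v hv => by
    rcases v with w | w
    · rfl
    · change (if (Sum.inr w : Place K) ∈ S' then ⊤ else unramifiedSubgroup (GaloisRep.toLocal w ρ₁) 1) = _
      rw [if_pos hv]
      rfl
  have h𝓖nS' : ∀ w : HeightOneSpectrum (𝓞 K), (Sum.inr w : Place K) ∉ S' →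
      𝓖 (Sum.inr w) = unramifiedSubgroup (GaloisRep.toLocal w ρ₁) 1 := fun w hw => by
    change (if (Sum.inr w : Place K) ∈ S' then ⊤ else unramifiedSubgroup (GaloisRep.toLocal w ρ₁) 1) = _
    rw [if_neg hw]
  have h𝓕S : ∀ v : Place K, v ∈ S → 𝓕 v = ⊤ := fun v hv => by
    rcases v with w | w
    · rfl
    · change (if (Sum.inr w : Place K) ∈ S then ⊤ else
        if w ∈ T then 𝓕loc w else unramifiedSubgroup (GaloisRep.toLocal w ρ₁) 1) = _
      rw [if_pos hv]
  have h𝓕T : ∀ w : HeightOneSpectrum (𝓞 K), (Sum.inr w : Place K) ∉ S → w ∈ T →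
      𝓕 (Sum.inr w) = 𝓕loc w := fun w hw hwT => by
    change (if (Sum.inr w : Place K) ∈ S then ⊤ else
      if w ∈ T then 𝓕loc w else unramifiedSubgroup (GaloisRep.toLocal w ρ₁) 1) = _
    rw [if_neg hw, if_pos hwT]
  have h𝓕nS' : ∀ w : HeightOneSpectrum (𝓞 K), (Sum.inr w : Place K) ∉ S → w ∉ T →
      𝓕 (Sum.inr w) = unramifiedSubgroup (GaloisRep.toLocal w ρ₁) 1 := fun w hw hwT => by
    change (if (Sum.inr w : Place K) ∈ S then ⊤ else
      if w ∈ T then 𝓕loc w else unramifiedSubgroup (GaloisRep.toLocal w ρ₁) 1) = _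
    rw [if_neg hw, if_neg hwT]
  -- `H¹_ur(M₁) ≤ 𝓕loc w` (functoriality of unramified classes)
  have hur_le_𝓕loc : ∀ w, unramifiedSubgroup (GaloisRep.toLocal w ρ₁) 1 ≤ 𝓕loc w := by
    intro w x hx
    change galoisCohomology.map (f.restrictField (w.adicCompletion K)) 1 x ∈
      unramifiedSubgroup (GaloisRep.toLocal w ρ₂) 1
    exact map_mem_unramifiedSubgroup (ρ₁ := GaloisRep.restrictField (w.adicCompletion K) ρ₁)
      (ρ₂ := GaloisRep.restrictField (w.adicCompletion K) ρ₂) (f.restrictField (w.adicCompletion K)) hx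
  have hle : 𝓕 ≤ 𝓖 := by
    intro v
    by_cases hv : v ∈ S'
    · rw [h𝓖S' v hv]; exact le_top
    · rcases v with w | w
      · exact absurd (hSS' (hSinf w)) hv
      · have hwS : (Sum.inr w : Place K) ∉ S := fun h' => hv (hSS' h')
        have hwT : w ∉ T := fun h' => hv ((memS' w).2 (Or.inr h'))
        rw [h𝓕nS' w hwS hwT, h𝓖nS' w hv]
  have hinf' : ∀ w : InfinitePlace K, (Sum.inl w : Place K) ∈ S' := fun w => hSS' (hSinf w)
  have h𝓖ur : 𝓖.IsUnramifiedOutside S' := ⟨hinf', fun w hw => h𝓖nS' w hw⟩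
  have h𝓕ur : 𝓕.IsUnramifiedOutside S' := ⟨hinf', fun w hw =>
    h𝓕nS' w (fun h' => hw (hSS' h')) (fun h' => hw ((memS' w).2 (Or.inr h')))⟩
  have hS'ρ₁ : ∀ v : HeightOneSpectrum (𝓞 K), (Sum.inr v : Place K) ∉ S' →
      ((n : ℕ) : 𝓞 K) ∉ v.asIdeal ∧ GaloisRep.IsUnramifiedAt v ρ₁ :=
    fun v hv => ⟨(hS v fun h' => hv (hSS' h')).1, (hS v fun h' => hv (hSS' h')).2.1⟩
  -- (5) the orthogonality hypothesis is vacuous: `H¹_{𝓕*}(K, M₁^D) = 0`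
  have horth : ∀ y ∈ (inv.dualSelmerStructure ρ₁ 𝓕).selmerGroup,
      ∑ v ∈ S', localTatePairingZMod ρ₁ n v (inv v) (t v)
        (galoisCohomology.localization (ρ₁.tateDual n) v 1 y) = 0 := by
    intro y hy
    rw [SelmerStructure.mem_selmerGroup_iff] at hy
    have hy0 : y = 0 := by
      refine hH₁ y (fun v hv => ?_) (fun w hw => ?_)
      · -- at `v ∈ S`: `𝓕_v = ⊤`, so `loc_v y` annihilates everything, hence vanishes
        have hyv := hy v
        rw [LocalInvariants.dualSelmerStructure_apply, h𝓕S v hv,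
          LocalInvariants.mem_dualLocalCondition_iff] at hyv
        have hinj := (bijective_localTatePairingZMod_place inv hperf hreal ρ₁ hM₁ v).2.1
        apply hinj
        rw [map_zero]
        exact AddMonoidHom.ext fun b => by
          rw [AddMonoidHom.flip_apply, AddMonoidHom.zero_apply]
          exact hyv b (AddSubgroup.mem_top b)
      · -- off `S`: `𝓕_w ⊇ H¹_ur(M₁)`, so `𝓕*_w ⊆ H¹_ur(M₁)^* = H¹_ur(M₁^D)` (Milne I 2.6)
        have hyw := hy (Sum.inr w)
        rw [LocalInvariants.dualSelmerStructure_apply] at hyw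
        have hsub : unramifiedSubgroup (GaloisRep.toLocal w ρ₁) 1 ≤ 𝓕 (Sum.inr w) := by
          by_cases hwT : w ∈ T
          · rw [h𝓕T w hw hwT]; exact hur_le_𝓕loc w
          · rw [h𝓕nS' w hw hwT]
        have h1 := inv.dualLocalCondition_anti ρ₁ (Sum.inr w) hsub hyw
        rwa [(hUO ρ₁ hM₁ w (hS w hw).1 (hS w hw).2.1).1] at h1
    subst hy0
    simp only [map_zero, Finset.sum_const_zero]
  -- (6) Howard's Thm. 2.1.11 for `M₁` at `S'`
  have ht : ∀ v ∈ S', t v ∈ 𝓖 v := fun v hv => by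
    rw [h𝓖S' v hv]; exact AddSubgroup.mem_top _
  obtain ⟨xA, hxA𝓖, hxA⟩ := exists_selmer_sub_mem_of_middleExact inv hperf hreal hUO ρ₁ hM₁ hS'ρ₁
    (hE₁ S' hSS') hle h𝓕ur h𝓖ur t ht horth
  rw [SelmerStructure.mem_selmerGroup_iff] at hxA𝓖
  -- (7) the corrected lift
  refine ⟨x20 - galoisCohomology.map f 1 xA, fun w hw => ?_, ?_⟩
  · change galoisCohomology.res ρ₂ (w.adicCompletion K) 1 (x20 - galoisCohomology.map f 1 xA) ∈ _
    rw [map_sub, galoisCohomology.res_map_one (w.adicCompletion K) f xA]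
    by_cases hwT : w ∈ T
    · -- `w ∈ T ∖ S`: both `loc x₂⁰ - f a_w` and `f (loc x_A - a_w)` are unramified
      have h1 := hxA (Sum.inr w) ((memS' w).2 (Or.inr hwT))
      rw [h𝓕T w hw hwT, ht_inr] at h1
      change galoisCohomology.map (f.restrictField (w.adicCompletion K)) 1
        (galoisCohomology.res ρ₁ (w.adicCompletion K) 1 xA - a w) ∈
        unramifiedSubgroup (GaloisRep.toLocal w ρ₂) 1 at h1
      rw [map_sub] at h1
      have h2 := ha w hw
      have e : galoisCohomology.res ρ₂ (w.adicCompletion K) 1 x20 -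
          galoisCohomology.map (f.restrictField (w.adicCompletion K)) 1
            (galoisCohomology.res ρ₁ (w.adicCompletion K) 1 xA) =
        (galoisCohomology.res ρ₂ (w.adicCompletion K) 1 x20 -
          galoisCohomology.map (f.restrictField (w.adicCompletion K)) 1 (a w)) -
        (galoisCohomology.map (f.restrictField (w.adicCompletion K)) 1
            (galoisCohomology.res ρ₁ (w.adicCompletion K) 1 xA) -
          galoisCohomology.map (f.restrictField (w.adicCompletion K)) 1 (a w)) := by abel
      rw [e]
      exact sub_mem h2 h1
    · -- `w ∉ S ∪ T`: `loc x₂⁰` and `loc x_A` are unramified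
      have h1 := hxA𝓖 (Sum.inr w)
      rw [h𝓖nS' w (fun h' => ((memS' w).1 h').elim hw hwT)] at h1
      exact sub_mem (hT w hwT) (map_mem_unramifiedSubgroup
        (ρ₁ := GaloisRep.restrictField (w.adicCompletion K) ρ₁)
        (ρ₂ := GaloisRep.restrictField (w.adicCompletion K) ρ₂) (f.restrictField (w.adicCompletion K)) h1)
  · rw [map_sub, hx20eq, map_map_eq_zero h, sub_zero]

end Summit.BirchSwinnertonDyer.BirchSwinnertonDyer.Theorems.KolyvaginRoadThreePT

end
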